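import Summits.QuantumFields.YangMills.Theorems.UnitScaleTiltFluctuationComparisonRegPrRestrictedLowerStep
import HarnessLib

/-!
# Route `UnitScaleTilt` — crux `FluctuationComparisonRegPrL` (stmt-QuantumFields-19935), STUB 3′ `stub_alphaTwoRunOfLane`, ADAPTER CONJUNCT
# `RepAtHeights` FOR THE CANONICAL v2 DATUM, PART 3: (41) AT THE TRIVIAL HISTORY FOR THE RESTRICTED HEIGHT DENSITY, WITH THE LANE'S
# TRIVIAL-HISTORY MASS — the one-step UPPER envelope from the (α) residual row `fibre49` and its propagation (support file `--supports stmt-QuantumFields-19935`)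

Fleet lead `ym-ust-19201-p1` (gen 4).  Parts 1–2 (`…RestrictedLowerStep`, `…RestrictedLower`) give the (47)-direction of `RepAtHeights (dataT3c …)`'s
a.e. clause.  THIS FILE gives the (41)-direction IN THE ONLY FORM THE ROWS SUPPORT: with the lane's trivial-history mass
`m_j(triv, W) = (inputOfAC 𝔠.lane X 𝔖).W.mass j triv W` (the uncapped Radon–Nikodym masses `MassesAC.massRecAC`, floored at `1` on the trivial history:
`m_{j+1}(triv) = max 1 (T_j[m_j(triv)])`, finding F-α1-1) as an EXTRA FACTOR.  For an exactly Haar-compatible averaging this mass is `1` and the factor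
disappears; for the route's `blockAvg ℰp` only absolute continuity is in the tree (`T3UnitLawDensityEML.haarAC_blockAvg`), so the factor is the honest
residual of the upper half (located-unprinted exact-Haar point, fleet finding af2a5b6fdc02c5ee).

* §7 `expo5558_le_expo41_succ` — over ANY `B10.TowerRun` with step leaves and `0 < g_k ≤ 1`: the (55)·(58) exponent of the upper step leaf at a new
  history `h` is below the (41)_{k+1} exponent at `h` (the arithmetic inside LQB's `ineq41_succ_of_leaves`, per history).
* §8 `upper41_oneStep_triv_ae` — tower currency, for the package's AC tower, `j + 1 ≤ K`: `T_j[w(triv′)·χB(triv′)·m_j(triv)·exp((41)_j at triv)] ≤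
  m_{j+1}(triv′)·exp((41)_{j+1} at triv′)` `dV`-a.e. — the row `StepAlphaAC.fibre49` at `h′ = triv′` (R3D-01), the mass recursion
  `MassesAC.transport_le_massRecAC_ae`, and §7.
* §9 `dataT3c_oneStep_upper` / `dataT3c_restricted41triv` — route currency and propagation by the frame (upper envelopes
  `u_j := e^{−Ecst_j + Rm_j}·m_j(triv)·low_j`, lower envelopes those of Part 1): for `n ≤ K`, a.e. on the window,
  `heightDensity F γ _ (histGood … K n) V ≤ e^{−Ecst_k + Rm_k}·m_k(triv, fieldShift V)·low_k(fieldShift V)`, `k = K − n`.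
CONDITIONAL on the (α) rows; nothing of [Balaban1985UV3] is asserted.

References: T. Bałaban, Commun. Math. Phys. 102 (1985) 255–275 [Balaban1985UV3] ((41) p.266, (48)–(49) p.268, (55) p.269, (58) p.270, p.271 L13, Thm 2 p.272).
-/

set_option autoImplicit false

noncomputable section

namespace Summit.QuantumFields.YangMills.Theorems.RepAtHeightsAdapter

open MeasureTheory Filter
open Literature.MathematicalPhysics.QuantumFieldTheory.Balaban1983to89
open Literature.MathematicalPhysics.QuantumFieldTheory.Balaban1983to89.B10 (TowerRun Ineq41 Ineq47)
open Literature.MathematicalPhysics.QuantumFieldTheory.Balaban1983to89.B10SectAGathering (StepPieces StepLeaves)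
open Literature.MathematicalPhysics.QuantumFieldTheory.Balaban1983to89.AveragingRT (rnTransport)
open Literature.MathematicalPhysics.QuantumFieldTheory.Balaban1983to89.T3ContinuumYM3Torus
open Literature.MathematicalPhysics.QuantumFieldTheory.Balaban1983to89.T3UnitLawDensityEML (ℰp measurableE_ℰp measurable_blockAvg haarAC_blockAvg rt)
open Literature.MathematicalPhysics.QuantumFieldTheory.Balaban1983to89.T3UnitScaleTilt (θBal histGood measurableSet_plaqSmall)
open Literature.MathematicalPhysics.QuantumFieldTheory.Balaban1983to89.T3LevelShift (fieldShift)
open Literature.MathematicalPhysics.QuantumFieldTheory.Balaban1983to89.T3RestrictedUnitDensity (towerDensity resDensity towerDensity_succ integrable_resDensity resDensity_nonneg)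
open Literature.MathematicalPhysics.QuantumFieldTheory.Balaban1983to89.T3TiltDescent (heightDensity)
open Literature.MathematicalPhysics.QuantumFieldTheory.Balaban1983to89.T3AlphaInputsAC
open Literature.MathematicalPhysics.QuantumFieldTheory.Balaban1983to89.Missing (boltzmann)
open Literature.MathematicalPhysics.QuantumFieldTheory.Balaban1985CMP102
open Literature.MathematicalPhysics.QuantumFieldTheory.Balaban1985CMP102.Setting
open Summit.QuantumFields.Balaban3D.Carriers
open Summit.QuantumFields.Balaban3D.Proofs.Primitives
open Summit.QuantumFields.Balaban3D.Proofs.ScalesArithmetic (gk_pos gk_le_one)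
open Summit.QuantumFields.Balaban3D.Proofs.TowerAC
open Summit.QuantumFields.Balaban3D.Proofs.StandardAC
open Summit.QuantumFields.Balaban3D.Proofs.InputsAC
open Summit.QuantumFields.Balaban3D.Proofs.AlphaAC
open Summit.QuantumFields.Balaban3D.Proofs.Bound55AC (hint_stdAC)
open Summit.QuantumFields.Balaban3D.Proofs.Bound55Masses (chiB chiB_nonneg chiB_le_one measurable_chiB measurable_stepWeight)
open Summit.QuantumFields.Balaban3D.Proofs.MassesAC (transport_le_massRecAC_ae)
open Summit.QuantumFields.Balaban3D.Proofs.Thm2AC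
open Summit.QuantumFields.YangMills.Theorems.LogComparisonSmallFieldRecursion
open Summit.QuantumFields.YangMills.Theorems.LogComparisonSmallFieldEnvelope

/-! ## §7 The (55)·(58) exponent of the upper step leaf is below the (41)_{k+1} exponent, per history (any `TowerRun`) -/

section Exponents

variable {T : TowerRun} {k : ℕ}

/-- **THE EXPONENT BOOKKEEPING OF THE UPPER STEP, PER NEW HISTORY** (the arithmetic inside LQB's `ineq41_succ_of_leaves`): given the step leaves at
step `k`, `k + 1 ≤ K` and `0 < g_k ≤ 1`, for every new history `h` and level-`(k+1)` datum `U`,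
`−mainT_{k+1}(h,U) − E_k + (log σ₀ + d(𝔤) log g_k)|B(Λ_{k+1}(h))*| + log Z^{(k)}(B,U) + Pold(h,U) + Zterm_k(proj h) + Rm_k + log Fl(h,U) ≤ −mainT_{k+1}(h,U) +
Pint_{k+1}(h,U) − E_{k+1} + Zterm_{k+1}(h) + Rm_{k+1}` — p.271 L13 «Complementing the constants in (55) to the full lattice T^{(k)}, and gathering together all
the transformations and estimates, we obtain the inductive inequality (41) for k replaced by k + 1» (leaves `Cumulant58`, `Repr33_60`, `VacuumWhole`,
`Decomp35_61`, `Norm35`, `StarCount` via `constants_complement`, `OldOutside`, `PintSucc`, `Estep62`, `ZtermSucc`, `RmSucc`, `Ecst_eq`).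
[cite: Balaban1985UV3, (55) p.269 + (58)–(62) pp.270–271 + p.271 L13] -/
theorem expo5558_le_expo41_succ (S : StepLeaves T k) (hk : k + 1 ≤ T.K) (hg : 0 < T.g k) (hg1 : T.g k ≤ 1)
    (hh : T.Hist (k + 1)) (U : T.Cfg (k + 1)) :
    -(T.mainT (k + 1) hh U) - T.Ecst k + (S.P.logσ₀ + S.P.dg * Real.log (T.g k)) * S.P.starB hh + S.P.logZU hh U + S.P.Pold hh U
        + T.Zterm k (S.P.proj hh) + T.Rm k + S.P.logFl hh U ≤
      -(T.mainT (k + 1) hh U) + T.Pint (k + 1) hh U - T.Ecst (k + 1) + T.Zterm (k + 1) hh + T.Rm (k + 1) := by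
  have hEcst : T.Ecst (k + 1) = T.Ecst k - T.Estep k := by
    rw [T.Ecst_eq, T.Ecst_eq, Finset.sum_eq_sum_Ico_succ_bot (by omega : k < T.K)]
    ring
  have hconst := B10SectAGathering.constants_complement S.P hg hg1 S.starCount hh
  have h58' := S.cumulant58 hh U
  have h60' := abs_le.1 (S.repr33_60 hh U)
  have hvac' := abs_le.1 (S.vacuumWhole hh)
  have h61' := abs_le.1 (S.decomp35_61 hh U)
  have h35' := abs_le.1 (S.norm35 hh)
  have hold' := abs_le.1 (S.oldOutside hh U)
  have hZ' := S.ztermSucc hh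
  have hR : B10SectAGathering.RmSucc S.P (S.C₁ + S.C₂ + S.C₃ + S.C₄) :=
    S.rmSucc.mono (by have := le_max_left S.C₁ S.C₁'; linarith)
  have hR' : T.Rm k + (S.C₁ + S.C₂ + S.C₃ + S.C₄) * S.P.rem ≤ T.Rm (k + 1) := hR
  rw [S.pintSucc hh U, hEcst, S.estep62]
  nlinarith [h58', h60'.1, h60'.2, hvac'.1, hvac'.2, h61'.1, h61'.2, h35'.1, h35'.2, hold'.1, hold'.2, hZ', hR', hconst,
    S.P.rem_nonneg, S.P.Zvol_nonneg hh]

end Exponents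

/-! ## §8 The one-step UPPER bound at the trivial new history for the package's tower (row `fibre49` + mass recursion) -/

section OneStepUpper

variable {F : T3Family} {𝔠 : AlphaConsts F.L (suGroupModel 2).N} {γ : ℝ} {hγ : 0 < γ} {hγ1 : γ ≤ (min 𝔠.gamma0 1) ^ 2} {K : ℕ}

/-- **THE UPPER STEP BOUND AT THE TRIVIAL NEW HISTORY FOR THE PACKAGE'S TOWER, `dV`-a.e.** (tower currency): for `j + 1 ≤ K`, almost everywhere on the
level-`(j+1)` fields, ONE renormalisation transformation of the (41)_j trivial-history summand weighted by the decomposition of unity at the trivial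
new history — `T_j[w_j(triv′)·χB_j(triv′)·m_j(triv)·exp(−mainT_j(triv) + Pint_j(triv) − E_j + Zterm_j(triv) + Rm_j)]` — is below the (41)_{j+1}
trivial-history summand `m_{j+1}(triv′)·exp(−mainT_{j+1}(triv′) + Pint_{j+1}(triv′) − E_{j+1} + Zterm_{j+1}(triv′) + Rm_{j+1})`: the (α) residual row
`StepAlphaAC.fibre49` at `h′ = triv′` (R3D-01, «The integral (49)» ≤ (55)·(58), transported), the exact-transport mass recursion
`MassesAC.transport_le_massRecAC_ae` (`T_j[w(triv′)·m_j(triv)] ≤ m_{j+1}(triv′)` a.e.) and `expo5558_le_expo41_succ`.  This is print's induction step for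
(41) restricted to the history WITHOUT large fields, carrying the lane's trivial mass. [cite: Balaban1985UV3, (48)–(49) p.268 + (55) p.269 + (58) p.270 + p.271 L13] -/
theorem upper41_oneStep_triv_ae (p : AlphaInputsT3AC.PkgAt F 𝔠 γ hγ hγ1 K) (j : ℕ) (hj : j + 1 ≤ K) :
    rnTransport (p.X.av j).avg (fun U =>
        stepWeight 𝔠.lane.carrier.M₁ (rcolOf (T3Scales F γ hγ (hγ1.trans (sq_min_one_le _ 𝔠.gamma0_pos)) K) 𝔠.lane.carrier)
            (eps1Of (T3Scales F γ hγ (hγ1.trans (sq_min_one_le _ 𝔠.gamma0_pos)) K) 𝔠.lane.carrier)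
            (epsSOf (T3Scales F γ hγ (hγ1.trans (sq_min_one_le _ 𝔠.gamma0_pos)) K) 𝔠.lane.carrier) j (Hist.triv (F.P K) (j + 1)) U *
          chiB 𝔠.lane.carrier.M₁ (rcolOf (T3Scales F γ hγ (hγ1.trans (sq_min_one_le _ 𝔠.gamma0_pos)) K) 𝔠.lane.carrier)
            (eps1Of (T3Scales F γ hγ (hγ1.trans (sq_min_one_le _ 𝔠.gamma0_pos)) K) 𝔠.lane.carrier) j (Hist.triv (F.P K) (j + 1)) U *
          ((inputOfAC 𝔠.lane p.X p.𝔖).W.mass j (Hist.triv (F.P K) j) U *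
            Real.exp (-(p.T.mainT j (p.T.triv j) U) + p.T.Pint j (p.T.triv j) U - p.T.Ecst j + p.T.Zterm j (p.T.triv j) + p.T.Rm j)))
      ≤ᵐ[fieldMeasure (F.P K) (j + 1) (Matrix.specialUnitaryGroup (Fin 2) ℂ)]
    fun V => (inputOfAC 𝔠.lane p.X p.𝔖).W.mass (j + 1) (Hist.triv (F.P K) (j + 1)) V *
      Real.exp (-(p.T.mainT (j + 1) (p.T.triv (j + 1)) V) + p.T.Pint (j + 1) (p.T.triv (j + 1)) V - p.T.Ecst (j + 1)
        + p.T.Zterm (j + 1) (p.T.triv (j + 1)) + p.T.Rm (j + 1)) := by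
  have h49 := (p.run.steps j hj).fibre49 (Hist.triv (F.P K) (j + 1))
  have hm := transport_le_massRecAC_ae 𝔠.lane.carrier.M₁ (rcolOf (T3Scales F γ hγ (hγ1.trans (sq_min_one_le _ 𝔠.gamma0_pos)) K) 𝔠.lane.carrier)
    (eps1Of (T3Scales F γ hγ (hγ1.trans (sq_min_one_le _ 𝔠.gamma0_pos)) K) 𝔠.lane.carrier)
    (epsSOf (T3Scales F γ hγ (hγ1.trans (sq_min_one_le _ 𝔠.gamma0_pos)) K) 𝔠.lane.carrier) p.X.av j (Hist.triv (F.P K) (j + 1))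
  filter_upwards [h49, hm] with V hV hmV
  refine hV.trans ?_
  refine mul_le_mul hmV (Real.exp_le_exp.mpr ?_) (Real.exp_nonneg _) ((inputOfAC 𝔠.lane p.X p.𝔖).W.mass_nonneg _ _ _)
  exact expo5558_le_expo41_succ
    (stepLeavesOfAC j hj (stepResidualsAC_of_alpha (T3Scales_window F 𝔠 γ hγ hγ1 K) j hj (p.run.steps j hj))) hj
    (gk_pos _ j) (gk_le_one _ (Scales.gK_le_one _) j (by show j ≤ K; omega)) _ V

end OneStepUpper

/-! ## §9 The one-step upper envelope in the route's currency and its propagation: (41) at the trivial history for the restricted density -/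

/-- Exponential bookkeeping: `e^{−(Ec−E)+Rm}·(M·e^{a}) = e^{E}·(M·e^{a−Ec+Rm})`. [folklore] -/
theorem exp_shuffle_up (M a Ec Rm E : ℝ) :
    Real.exp (-(Ec - E) + Rm) * (M * Real.exp a) = Real.exp E * (M * Real.exp (a - Ec + Rm)) := by
  have h1 : Real.exp (-(Ec - E) + Rm) = Real.exp E * Real.exp (-Ec + Rm) := by
    rw [← Real.exp_add]; congr 1; ring
  have h2 : Real.exp (a - Ec + Rm) = Real.exp a * Real.exp (-Ec + Rm) := by
    rw [← Real.exp_add]; congr 1; ring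
  rw [h1, h2]; ring

section RestrictedUpper

variable {F : T3Family} {𝔠 : AlphaConsts F.L (suGroupModel 2).N} {a₀ a₁ : ℝ}
  (h : AlphaInputsT3AC.OfV2At F 𝔠 a₀ a₁) (hc : 0 < a₀ ∧ 0 < a₁ ∧ 𝔠.B₃ * a₁ ≤ a₀) (γ : ℝ) (hγ : 0 < γ)
  (hγ1 : γ ≤ (min 𝔠.gamma0 1) ^ 2) (π : AlphaInputsT3AC.PolymerT3 F)

/-- **OFF THE WINDOW THE UPPER ENVELOPE'S TRANSPORTED INTEGRAND VANISHES, ON IT IT IS `e^{E}` TIMES THE ROW'S**: the level-`j` window's indicator times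
`u_j := e^{−Ecst_j + Rm_j}·m_j(triv)·low_j` equals `e^{E}` times the integrand of the row `fibre49` at the trivial new history
(`w_j(triv′) = 1`: `stepWeight_triv`; `χB_j(triv′)` = the window's indicator: `Hist.last_triv`, `Omega_triv`, `PkgAt.eps1_eq`; `Zterm_j(triv) = 0`).
[cite: Balaban1985UV3, (41) p.266 + (49) p.268] -/
theorem dataT3c_indicator_upper_eq (K j : ℕ) (hj : j ≤ K) :
    {W' : GaugeField (F.P K) j (Matrix.specialUnitaryGroup (Fin 2) ℂ) | PlaqSmall (θBal F.L γ 𝔠.b₀ 𝔠.p₀ (K - j)) W'}.indicator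
        (fun W' => Real.exp (-((h.dataT3c hc γ hγ hγ1 π).Ecst K j) + (h.dataT3c hc γ hγ hγ1 π).Rm K j) *
          ((inputOfAC 𝔠.lane (h.pkgAtV2 hc γ hγ hγ1 K).X (h.pkgAtV2 hc γ hγ hγ1 K).𝔖).W.mass j (Hist.triv (F.P K) j) W' *
            (h.dataT3c hc γ hγ hγ1 π).low K j W')) =
      fun U => Real.exp (h.pkgAtV2 hc γ hγ hγ1 K).E *
        (stepWeight 𝔠.lane.carrier.M₁ (rcolOf (T3Scales F γ hγ (hγ1.trans (sq_min_one_le _ 𝔠.gamma0_pos)) K) 𝔠.lane.carrier)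
            (eps1Of (T3Scales F γ hγ (hγ1.trans (sq_min_one_le _ 𝔠.gamma0_pos)) K) 𝔠.lane.carrier)
            (epsSOf (T3Scales F γ hγ (hγ1.trans (sq_min_one_le _ 𝔠.gamma0_pos)) K) 𝔠.lane.carrier) j (Hist.triv (F.P K) (j + 1)) U *
          chiB 𝔠.lane.carrier.M₁ (rcolOf (T3Scales F γ hγ (hγ1.trans (sq_min_one_le _ 𝔠.gamma0_pos)) K) 𝔠.lane.carrier)
            (eps1Of (T3Scales F γ hγ (hγ1.trans (sq_min_one_le _ 𝔠.gamma0_pos)) K) 𝔠.lane.carrier) j (Hist.triv (F.P K) (j + 1)) U *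
          ((inputOfAC 𝔠.lane (h.pkgAtV2 hc γ hγ hγ1 K).X (h.pkgAtV2 hc γ hγ hγ1 K).𝔖).W.mass j (Hist.triv (F.P K) j) U *
            Real.exp (-((h.pkgAtV2 hc γ hγ hγ1 K).T.mainT j ((h.pkgAtV2 hc γ hγ hγ1 K).T.triv j) U)
              + (h.pkgAtV2 hc γ hγ hγ1 K).T.Pint j ((h.pkgAtV2 hc γ hγ hγ1 K).T.triv j) U - (h.pkgAtV2 hc γ hγ hγ1 K).T.Ecst j
              + (h.pkgAtV2 hc γ hγ hγ1 K).T.Zterm j ((h.pkgAtV2 hc γ hγ hγ1 K).T.triv j) + (h.pkgAtV2 hc γ hγ hγ1 K).T.Rm j))) := by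
  have hε : eps1Of (T3Scales F γ hγ (hγ1.trans (sq_min_one_le _ 𝔠.gamma0_pos)) K) 𝔠.lane.carrier j = θBal F.L γ 𝔠.b₀ 𝔠.p₀ (K - j) :=
    (h.pkgAtV2 hc γ hγ hγ1 K).toPkgAt.eps1_eq j hj
  have hZ : (h.pkgAtV2 hc γ hγ hγ1 K).T.Zterm j ((h.pkgAtV2 hc γ hγ hγ1 K).T.triv j) = 0 := (h.pkgAtV2 hc γ hγ hγ1 K).T.Zterm_triv j
  have hw : ∀ U : GaugeField (F.P K) j (Matrix.specialUnitaryGroup (Fin 2) ℂ),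
      stepWeight 𝔠.lane.carrier.M₁ (rcolOf (T3Scales F γ hγ (hγ1.trans (sq_min_one_le _ 𝔠.gamma0_pos)) K) 𝔠.lane.carrier)
        (eps1Of (T3Scales F γ hγ (hγ1.trans (sq_min_one_le _ 𝔠.gamma0_pos)) K) 𝔠.lane.carrier)
        (epsSOf (T3Scales F γ hγ (hγ1.trans (sq_min_one_le _ 𝔠.gamma0_pos)) K) 𝔠.lane.carrier) j (Hist.triv (F.P K) (j + 1)) U = 1 :=
    fun U => stepWeight_triv _ _ _ _ (by show j ≤ F.m + K; omega) U
  funext U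
  by_cases hs : PlaqSmall (θBal F.L γ 𝔠.b₀ 𝔠.p₀ (K - j)) U
  · rw [Set.indicator_of_mem (show U ∈ {W' | PlaqSmall (θBal F.L γ 𝔠.b₀ 𝔠.p₀ (K - j)) W'} from hs)]
    have hχB : chiB 𝔠.lane.carrier.M₁ (rcolOf (T3Scales F γ hγ (hγ1.trans (sq_min_one_le _ 𝔠.gamma0_pos)) K) 𝔠.lane.carrier)
        (eps1Of (T3Scales F γ hγ (hγ1.trans (sq_min_one_le _ 𝔠.gamma0_pos)) K) 𝔠.lane.carrier) j (Hist.triv (F.P K) (j + 1)) U = 1 := by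
      unfold chiB
      rw [if_pos]
      intro q _ _
      rw [hε]
      exact hs q
    have hχ : (h.pkgAtV2 hc γ hγ hγ1 K).T.χ j U = 1 := by
      show (h.dataT3c hc γ hγ hγ1 π).χ K j U = 1
      rw [h.dataT3c_chi_eq hc γ hγ hγ1 π K j hj]
      unfold chiSmall
      exact if_pos (show PlaqSmallOn Set.univ (θBal F.L γ 𝔠.b₀ 𝔠.p₀ (K - j)) U from fun q _ => hs q)
    show Real.exp (-((h.pkgAtV2 hc γ hγ hγ1 K).T.Ecst j - (h.pkgAtV2 hc γ hγ hγ1 K).E) + (h.pkgAtV2 hc γ hγ hγ1 K).T.Rm j) *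
        ((inputOfAC 𝔠.lane (h.pkgAtV2 hc γ hγ hγ1 K).X (h.pkgAtV2 hc γ hγ hγ1 K).𝔖).W.mass j (Hist.triv (F.P K) j) U *
          ((h.pkgAtV2 hc γ hγ hγ1 K).T.χ j U *
            Real.exp (-((h.pkgAtV2 hc γ hγ hγ1 K).T.mainT j ((h.pkgAtV2 hc γ hγ hγ1 K).T.triv j) U)
              + (h.pkgAtV2 hc γ hγ hγ1 K).T.Pint j ((h.pkgAtV2 hc γ hγ hγ1 K).T.triv j) U))) = _
    rw [hw U, hχB, hZ, hχ, add_zero]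
    simp only [one_mul]
    exact exp_shuffle_up _ _ _ _ _
  · rw [Set.indicator_of_notMem (show U ∉ {W' | PlaqSmall (θBal F.L γ 𝔠.b₀ 𝔠.p₀ (K - j)) W'} from hs)]
    have hχB : chiB 𝔠.lane.carrier.M₁ (rcolOf (T3Scales F γ hγ (hγ1.trans (sq_min_one_le _ 𝔠.gamma0_pos)) K) 𝔠.lane.carrier)
        (eps1Of (T3Scales F γ hγ (hγ1.trans (sq_min_one_le _ 𝔠.gamma0_pos)) K) 𝔠.lane.carrier) j (Hist.triv (F.P K) (j + 1)) U = 0 := by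
      unfold chiB
      rw [if_neg]
      intro hall
      apply hs
      intro q
      have hq := hall q (by simp [Hist.last_triv]) (by rw [Omega_triv]; exact Set.subset_univ _)
      rw [hε] at hq
      exact hq
    rw [hχB, mul_zero, zero_mul, mul_zero]

/-- **THE ONE-STEP UPPER ENVELOPE IN THE ROUTE'S CURRENCY** (the `hstep` input of `LogComparisonSmallFieldEnvelope.sandwich_of_oneStep`, upper half):
for `j + 1 ≤ K`, almost everywhere on the window of level `j + 1` of run `K`, `T_j(𝟙_{window j}·u_j) ≤ u_{j+1}` with
`u_j := e^{−Ecst_j + Rm_j}·m_j(triv)·low_j` — `dataT3c_indicator_upper_eq`, the `dV`-a.e. homogeneity of the transport under `e^{E}`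
(integrability of the row's integrand: `Bound55AC.hint_stdAC` times the bounded weights), `upper41_oneStep_triv_ae`, and on the window `χ_{j+1} = 1`,
`Zterm_{j+1}(triv′) = 0`. [cite: Balaban1985UV3, (41) p.266 + (55) p.269 + p.271 L13] -/
theorem dataT3c_oneStep_upper (K j : ℕ) (hj : j + 1 ≤ K) :
    ∀ᵐ W ∂fieldMeasure (F.P K) (j + 1) (Matrix.specialUnitaryGroup (Fin 2) ℂ), PlaqSmall (θBal F.L γ 𝔠.b₀ 𝔠.p₀ (K - (j + 1))) W →
      (rt F K j (by omega)).T
          ({W' : GaugeField (F.P K) j (Matrix.specialUnitaryGroup (Fin 2) ℂ) | PlaqSmall (θBal F.L γ 𝔠.b₀ 𝔠.p₀ (K - j)) W'}.indicator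
            (fun W' => Real.exp (-((h.dataT3c hc γ hγ hγ1 π).Ecst K j) + (h.dataT3c hc γ hγ hγ1 π).Rm K j) *
              ((inputOfAC 𝔠.lane (h.pkgAtV2 hc γ hγ hγ1 K).X (h.pkgAtV2 hc γ hγ hγ1 K).𝔖).W.mass j (Hist.triv (F.P K) j) W' *
                (h.dataT3c hc γ hγ hγ1 π).low K j W'))) W ≤
        Real.exp (-((h.dataT3c hc γ hγ hγ1 π).Ecst K (j + 1)) + (h.dataT3c hc γ hγ hγ1 π).Rm K (j + 1)) *
          ((inputOfAC 𝔠.lane (h.pkgAtV2 hc γ hγ hγ1 K).X (h.pkgAtV2 hc γ hγ hγ1 K).𝔖).W.mass (j + 1) (Hist.triv (F.P K) (j + 1)) W *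
            (h.dataT3c hc γ hγ hγ1 π).low K (j + 1) W) := by
  have hj' : j + 1 ≤ F.m + K := by omega
  have hA := upper41_oneStep_triv_ae (h.pkgAtV2 hc γ hγ hγ1 K).toPkgAt j hj
  have hav : (h.pkgAtV2 hc γ hγ hγ1 K).toPkgAt.X.av j = BlockAveraging.blockAvg (P := F.P K) (j := j) ℰp := by
    show avT3 F K j = _
    exact avT3_of_le F K hj'
  rw [hav] at hA
  -- integrability and non-negativity of the row's integrand
  have A := (h.pkgAtV2 hc γ hγ hγ1 K).run.steps j hj
  have hint := hint_stdAC (h.pkgAtV2 hc γ hγ hγ1 K).toPkgAt.X 𝔠.lane.carrier (h.pkgAtV2 hc γ hγ hγ1 K).𝔖 (fun _ => True) j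
    A.hU A.hPm ((h.pkgAtV2 hc γ hγ hγ1 K).𝔄.cP j) A.hPb (Hist.triv (F.P K) j)
  have hmeas : AEStronglyMeasurable (fun U : GaugeField (F.P K) j (Matrix.specialUnitaryGroup (Fin 2) ℂ) =>
      stepWeight 𝔠.lane.carrier.M₁ (rcolOf (T3Scales F γ hγ (hγ1.trans (sq_min_one_le _ 𝔠.gamma0_pos)) K) 𝔠.lane.carrier)
          (eps1Of (T3Scales F γ hγ (hγ1.trans (sq_min_one_le _ 𝔠.gamma0_pos)) K) 𝔠.lane.carrier)
          (epsSOf (T3Scales F γ hγ (hγ1.trans (sq_min_one_le _ 𝔠.gamma0_pos)) K) 𝔠.lane.carrier) j (Hist.triv (F.P K) (j + 1)) U *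
        chiB 𝔠.lane.carrier.M₁ (rcolOf (T3Scales F γ hγ (hγ1.trans (sq_min_one_le _ 𝔠.gamma0_pos)) K) 𝔠.lane.carrier)
          (eps1Of (T3Scales F γ hγ (hγ1.trans (sq_min_one_le _ 𝔠.gamma0_pos)) K) 𝔠.lane.carrier) j (Hist.triv (F.P K) (j + 1)) U)
      (fieldMeasure (F.P K) j (Matrix.specialUnitaryGroup (Fin 2) ℂ)) :=
    ((measurable_stepWeight _ _ _ _ j _).mul (measurable_chiB _ _ _ j _)).aestronglyMeasurable
  have hbd : ∀ᵐ U ∂fieldMeasure (F.P K) j (Matrix.specialUnitaryGroup (Fin 2) ℂ),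
      ‖stepWeight 𝔠.lane.carrier.M₁ (rcolOf (T3Scales F γ hγ (hγ1.trans (sq_min_one_le _ 𝔠.gamma0_pos)) K) 𝔠.lane.carrier)
          (eps1Of (T3Scales F γ hγ (hγ1.trans (sq_min_one_le _ 𝔠.gamma0_pos)) K) 𝔠.lane.carrier)
          (epsSOf (T3Scales F γ hγ (hγ1.trans (sq_min_one_le _ 𝔠.gamma0_pos)) K) 𝔠.lane.carrier) j (Hist.triv (F.P K) (j + 1)) U *
        chiB 𝔠.lane.carrier.M₁ (rcolOf (T3Scales F γ hγ (hγ1.trans (sq_min_one_le _ 𝔠.gamma0_pos)) K) 𝔠.lane.carrier)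
          (eps1Of (T3Scales F γ hγ (hγ1.trans (sq_min_one_le _ 𝔠.gamma0_pos)) K) 𝔠.lane.carrier) j (Hist.triv (F.P K) (j + 1)) U‖ ≤ 1 :=
    ae_of_all _ fun U => by
      rw [Real.norm_eq_abs, abs_of_nonneg (mul_nonneg (stepWeight_nonneg _ _ _ _ j _ U) (chiB_nonneg _ _ _ j _ U))]
      exact mul_le_one₀ (stepWeight_le_one _ _ _ _ j _ U) (chiB_nonneg _ _ _ j _ U) (chiB_le_one _ _ _ j _ U)
  have hint49 := hint.bdd_mul hmeas hbd
  have h0 : ∀ U : GaugeField (F.P K) j (Matrix.specialUnitaryGroup (Fin 2) ℂ),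
      0 ≤ stepWeight 𝔠.lane.carrier.M₁ (rcolOf (T3Scales F γ hγ (hγ1.trans (sq_min_one_le _ 𝔠.gamma0_pos)) K) 𝔠.lane.carrier)
            (eps1Of (T3Scales F γ hγ (hγ1.trans (sq_min_one_le _ 𝔠.gamma0_pos)) K) 𝔠.lane.carrier)
            (epsSOf (T3Scales F γ hγ (hγ1.trans (sq_min_one_le _ 𝔠.gamma0_pos)) K) 𝔠.lane.carrier) j (Hist.triv (F.P K) (j + 1)) U *
          chiB 𝔠.lane.carrier.M₁ (rcolOf (T3Scales F γ hγ (hγ1.trans (sq_min_one_le _ 𝔠.gamma0_pos)) K) 𝔠.lane.carrier)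
            (eps1Of (T3Scales F γ hγ (hγ1.trans (sq_min_one_le _ 𝔠.gamma0_pos)) K) 𝔠.lane.carrier) j (Hist.triv (F.P K) (j + 1)) U *
          ((inputOfAC 𝔠.lane (h.pkgAtV2 hc γ hγ hγ1 K).X (h.pkgAtV2 hc γ hγ hγ1 K).𝔖).W.mass j (Hist.triv (F.P K) j) U *
            Real.exp (-((h.pkgAtV2 hc γ hγ hγ1 K).T.mainT j ((h.pkgAtV2 hc γ hγ hγ1 K).T.triv j) U)
              + (h.pkgAtV2 hc γ hγ hγ1 K).T.Pint j ((h.pkgAtV2 hc γ hγ hγ1 K).T.triv j) U - (h.pkgAtV2 hc γ hγ hγ1 K).T.Ecst j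
              + (h.pkgAtV2 hc γ hγ hγ1 K).T.Zterm j ((h.pkgAtV2 hc γ hγ hγ1 K).T.triv j) + (h.pkgAtV2 hc γ hγ hγ1 K).T.Rm j)) :=
    fun U => mul_nonneg (mul_nonneg (stepWeight_nonneg _ _ _ _ j _ U) (chiB_nonneg _ _ _ j _ U))
      (mul_nonneg ((inputOfAC 𝔠.lane (h.pkgAtV2 hc γ hγ hγ1 K).X (h.pkgAtV2 hc γ hγ hγ1 K).𝔖).W.mass_nonneg _ _ _) (Real.exp_nonneg _))
  have hhom := rnTransport_const_mul_ae (BlockAveraging.blockAvg (P := F.P K) (j := j) ℰp).avg _ h0 hint49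
    (Real.exp_nonneg (h.pkgAtV2 hc γ hγ hγ1 K).E)
  have hZ : (h.pkgAtV2 hc γ hγ hγ1 K).T.Zterm (j + 1) ((h.pkgAtV2 hc γ hγ hγ1 K).T.triv (j + 1)) = 0 :=
    (h.pkgAtV2 hc γ hγ hγ1 K).T.Zterm_triv (j + 1)
  rw [dataT3c_indicator_upper_eq h hc γ hγ hγ1 π K j (by omega)]
  filter_upwards [hA, hhom] with W hAW hhomW hs
  have hχ : (h.dataT3c hc γ hγ hγ1 π).χ K (j + 1) W = 1 := by
    rw [h.dataT3c_chi_eq hc γ hγ hγ1 π K (j + 1) hj]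
    unfold chiSmall
    exact if_pos (show PlaqSmallOn Set.univ (θBal F.L γ 𝔠.b₀ 𝔠.p₀ (K - (j + 1))) W from fun q _ => hs q)
  show rnTransport (BlockAveraging.blockAvg (P := F.P K) (j := j) ℰp).avg _ W ≤ _
  refine (le_of_eq hhomW).trans ?_
  refine (mul_le_mul_of_nonneg_left hAW (Real.exp_nonneg _)).trans (le_of_eq ?_)
  -- `e^{E}·m_{j+1}(triv′)·exp((41)_{j+1} at triv′) = u_{j+1}` on the window
  have hχ' : (h.pkgAtV2 hc γ hγ hγ1 K).T.χ (j + 1) W = 1 := hχ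
  show _ = Real.exp (-((h.pkgAtV2 hc γ hγ hγ1 K).T.Ecst (j + 1) - (h.pkgAtV2 hc γ hγ hγ1 K).E) + (h.pkgAtV2 hc γ hγ hγ1 K).T.Rm (j + 1)) *
      ((inputOfAC 𝔠.lane (h.pkgAtV2 hc γ hγ hγ1 K).X (h.pkgAtV2 hc γ hγ hγ1 K).𝔖).W.mass (j + 1) (Hist.triv (F.P K) (j + 1)) W *
        ((h.pkgAtV2 hc γ hγ hγ1 K).T.χ (j + 1) W *
          Real.exp (-((h.pkgAtV2 hc γ hγ hγ1 K).T.mainT (j + 1) ((h.pkgAtV2 hc γ hγ hγ1 K).T.triv (j + 1)) W)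
            + (h.pkgAtV2 hc γ hγ hγ1 K).T.Pint (j + 1) ((h.pkgAtV2 hc γ hγ hγ1 K).T.triv (j + 1)) W)))
  rw [hZ, add_zero, hχ']
  simp only [one_mul]
  exact (exp_shuffle_up _ _ _ _ _).symm

end RestrictedUpper

end Summit.QuantumFields.YangMills.Theorems.RepAtHeightsAdapter

end
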